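import Summits.ABC.IUTFork.Charitable.Thm311D4Derive
import Summits.ABC.IUTFork.Charitable.Thm311D4TransportBeds
import Summits.ABC.IUTFork.Charitable.Thm311D4Checks
import Summits.ABC.IUTFork.Joshi.TestGenuinePinsAnyQIdele
import Summits.ABC.IUTFork.Cor312NotLicenceRealSharp
import Summits.ABC.IUTFork.Thm311RealThetaPilotFree
import HarnessLib

/-!
# Block D, team D4 — the charitable reading AT THE GENUINE CARRIERS: conservative without the pins, unsatisfiable with them

PROOF-ONLY companion (0 definitions, no `Prop` fact, no instance, no notation, no `sorry`) of the abc-iut cell (seat abc-iut-D4-prv,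
gen 5; block D «maximally-charitable re-typings of [IUTchIII] Thm. 3.11», team D4, rung LADDER-ABC:A2.D). TAKES NO SIDE on [IUTchIII]
Cor. 3.12 or on any author (Mochizuki / Scholze–Stix / Joshi / Dupuy–Hilado); typed ≠ proved; locates / conditionally verifies; no abc
claim. Imports BY NAME only: abc-iut-D4-typ's frozen typing `Thm311Charitable_4` (p433089) with its checks (p433449), this seat's deriver
(p433392) and transport beds (p455538), abc-iut-E-t44's genuine-carrier test `Joshi/TestGenuinePinsAnyQIdele` («(ii)(b) + two region pins
⟹ ¬S at the sharp genuine setting, for EVERY q-idele»), abc-iut-C-cert-1's `Cor312NotLicenceRealSharp` (E3: the (xi-f) `Licence` fails at a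
deep unramified odd prime) and abc-iut-c312-7's closed real full situation `Thm311RealThetaPilotFree` (p447671).

## What block D had on TOY carriers, and what this file adds

Team D4's record (plan/D-ref/GRADE.md §L): (a) `Thm311Charitable_4 ∧ PinnedRegions3 ⟹ S` (p433392); (T-c) the conjunction is SATISFIABLE —
at abc-iut-w5-d230's natural model P♮ (`charitable_4_satisfiable_with_pins`, a toy `l⋇ = 2` carrier); (b) it FAILS at PR-2's pinned
countermodel (p434663). The referees' (c): FAITHFUL-AT-CEILING. Every bed so far is a toy. This file reads the same typing at the
cell's GENUINE carriers and separates the two ingredients of the conjunction: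

* §1 **CONSERVATIVITY (model-free).** Over EVERY lattice situation, `∃ Q, Thm311Charitable_4 S Q ⟺ S.PartI ∧ S.PartII`
  (`exists_charitable_4_iff`): the maximally-charitable (iii) + (Q′) + (L) is satisfiable by the PREVIOUS-COLUMN datum of p455538
  (`D4TransportBeds.prevColumnData`, (L) on the nose) as soon as the frozen (i)(ii) hold — abc-iut-D4-typ's `nfLinkCompat_of_partI_partII`
  supplies (iii)(d). In particular it holds at abc-iut-c312-7's CLOSED REAL full situation (`exists_real_charitable_4`). So the charitable
  clause (L) BY ITSELF carries no refutable content at any carrier: it never mentions the Corollary's q-pilot REGION.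
* §2 **THE PINS CARRY THE CONTENT (model-free schemas).** `Thm311Charitable_4 ∧ PinnedRegions` (two region pins, q-datum `Q.qΨ P.n m₁`)
  gives the (xi-f) `Licence` (`licence_of_charitable_4_pinned`, the two-pin form of the kit's `licence_of_s`); hence the conjunction is
  refuted wherever «(ii)(b) + pins ⟹ ¬S» holds (`not_charitable_4_and_pinned_of_not_s`) or the `Licence` fails
  (`not_charitable_4_and_pinned_of_not_licence`); the (Ind3)-hedged reading (L^⊆) of p437900 with a MONOTONE region reading likewise
  (`not_upper_4_and_pinned_of_not_licence`, through p443687 `D4Upper.licence_of_upper`).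
* §3 **GENUINE CARRIERS — UNSATISFIABLE WITH THE PINS, for every initial Θ-datum.** At abc-iut-c312-7's print-normalised sharp setting
  `settingPrVolSharp` over the real lattice situation `LatticeSituation.ofShells (logShellsDH X logv) …` of ANY initial Θ-datum `X`
  (Θ-ideles realising `P_Θ`, ANY nonzero q-idele family that is a unit off `S`, all context binders free), for EVERY link/Kummer datum
  `Q`, EVERY region reading `ρ` and EVERY vertical index `m₁`: `¬ (Thm311Charitable_4 ∧ Cor312Vol.PinnedRegions … ρ (Q.qΨ n m₁))`
  (`not_charitable_4_and_pinned_settingPrVolSharp`; three-pin form `…_pinned3_…`) — abc-iut-E-t44's label-1/label-2 volume mismatch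
  (`not_pilotKummerIndRelated_settingPrVolSharp_of_pinned_anyQ`) against p433392's pin-free S. While, at the same carrier,
  `∃ Q, Thm311Charitable_4 ⟺ (i) ∧ (ii)` (§1). `genuine_census` packages both.
* §4 **GENUINE CARRIERS, DEEP PLACE — the hedged reading too.** At a label `j ≥ 2` over a bad place above an odd prime `p ∤ disc F`, with
  REALISING q-ideles, the `Licence` fails (abc-iut-C-cert-1 `not_licence_settingPrVolSharp_of_realising`), so for every column structure,
  link/Kummer datum, MONOTONE region reading and `m₁`: `¬ ((Thm311Literal_4 ∧ QKummerCoric ∧ LinkKummerCompatUpper) ∧ RegionMonotone ∧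
  PinnedRegions)` (`not_upper_4_and_pinned_settingPrVolSharp_of_realising`). (At TAME data the `Licence` holds — e.g. abc-iut-D3-prv's
  `Thm311D3TameBed` — and this route decides nothing about the hedged conjunction; not claimed.)

ONE SENTENCE (neutral, for the D referees' additive record): in kernel, team D4's maximally-charitable Theorem 3.11 is EQUISATISFIABLE
with the frozen literal (i) ∧ (ii) on every carrier, genuine ones included; what is unsatisfiable at every genuine carrier — for every
q-idele, region reading and link datum — is its conjunction with the Corollary's two REGION PINS, i.e. the identification of the
charitable q-datum's region with the q-pilot region of Cor. 3.12 (the located gap G read at genuine data: abc-iut-E-t44's volume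
mismatch `A_p ≠ 4·A_p` at labels 1, 2). Whether print asserts that identification ((xi-d)–(xi-f), Rmk. 3.11.1 (ii)–(v)) is the referees'
question, untouched here. [claim: Mochizuki2012, status: disputed] for every IUT quotation; [cite: ScholzeStix2018, §2.2 pp. 9–10]
(the identification denied there); [cite: DupuyHilado2025, §3.3–§3.4, Thm. 3.10.1] (realising ideles). Standard axioms only.
-/

noncomputable section

open Set Function NumberField IsDedekindDomain

namespace Summit.ABC.IUTFork.Charitable.D4Genuine

open Thm311 hiding toyIndex
open Thm311.Real Cor312 Cor312Vol Literature.IUT.LogThetaLattice Literature.IUT.LogVolume Literature.IUT.HodgeTheaters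
open Summit.ABC.IUTFork.Charitable.D4 Summit.ABC.IUTFork.Charitable.D4Derive Summit.ABC.IUTFork.Charitable.D4TransportBeds
  Summit.ABC.IUTFork.Charitable.D4Upper Summit.ABC.IUTFork.Joshi

/-! ## 1. Conservativity: the charitable reading is satisfiable wherever the frozen (i)(ii) hold -/

section Conservative

variable {T : ThetaIndex} (S : LatticeSituation T)

/-- **`Thm311Charitable_4` holds for the PREVIOUS-COLUMN datum in every lattice situation satisfying the frozen (i) ∧ (ii).** (L) on the
nose, (Q′), (iii)(a)(b), (iii)(c)(d)-letter: p455538 §1; (iii)(d)-final `NFLinkCompat`: abc-iut-D4-typ's `nfLinkCompat_of_partI_partII`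
((i) `MultiradialCompat` ∧ (ii)(c)). [claim: Mochizuki2012, status: disputed] -/
theorem charitable_4_prevColumnData (h1 : S.PartI) (h2 : S.PartII) :
    Summit.ABC.IUTFork.Charitable.Thm311Charitable_4 S (prevColumnData S) :=
  ⟨h1, h2, qKummerCoric_prevColumnData S, partIII_charitable_prevColumnData S (nfLinkCompat_of_partI_partII h1 h2)⟩

/-- **CONSERVATIVITY / EQUISATISFIABILITY (model-free).** Over every lattice situation: SOME link/Kummer datum satisfies team D4's
maximally-charitable Theorem 3.11 ⟺ the frozen literal (i) ∧ (ii) hold. (The Setting-free form of abc-iut-D3-typ's `DConcordance.charitable_4_iff`,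
which fixes the q-field at a pins' binder.) [claim: Mochizuki2012, status: disputed] -/
theorem exists_charitable_4_iff :
    (∃ Q : LinkKummerData S, Summit.ABC.IUTFork.Charitable.Thm311Charitable_4 S Q) ↔ S.PartI ∧ S.PartII :=
  ⟨fun ⟨_, h⟩ => ⟨h.1, h.2.1⟩, fun h => ⟨_, charitable_4_prevColumnData S h.1 h.2⟩⟩

/-- **At a CLOSED REAL carrier**: abc-iut-c312-7's real full situation over `ℚ` (p447671 `exists_real_fullSituation_statement`: every
(iii)-object, glue and column instantiated by tree objects, typed Thm. 3.11 (i)–(iii) HOLDS) carries a link/Kummer datum satisfying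
`Thm311Charitable_4` — the charitable reading is inhabited at a genuine (non-toy) carrier, with no pin in sight.
[claim: Mochizuki2012, status: disputed] -/
theorem exists_real_charitable_4 :
    ∃ (X : PilotData ℚ) (Sit : Thm311.FullSituation (thetaIndex X)) (Q : LinkKummerData Sit.toLatticeSituation),
      Sit.Statement ∧ Summit.ABC.IUTFork.Charitable.Thm311Charitable_4 Sit.toLatticeSituation Q := by
  obtain ⟨X, Sit, h⟩ := exists_real_fullSituation_statement
  exact ⟨X, Sit, _, h, charitable_4_prevColumnData Sit.toLatticeSituation h.1 h.2.1⟩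

end Conservative

/-! ## 2. The pins carry the content: model-free schemas -/

section Pins

variable {T : ThetaIndex} (S : LatticeSituation T) (P : Cor312.Setting S.toSituation)
  (ρ : (∀ v : T.V, v ∈ T.Vbad → Set (S.L.StarPacket v)) → ∀ (j : T.Label) (vQ : T.VQ), Set (S.L.Packet j vQ))

/-- S under the TWO region pins and (ii)(b) for column `n` gives abc-iut-c312-1's (xi-f) `Licence` (READING R3 at every label of `𝔽_l^⋇`;
the kit's `licence_of_s` with the idle link pin dropped). [claim: Mochizuki2012, status: disputed] -/
theorem licence_of_s_pinned {qK : ∀ v : T.V, v ∈ T.Vbad → Set (S.L.StarPacket v)}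
    (hKumB : (S.col P.n).KummerB (S.D P.n)) (hpin : PinnedRegions S P ρ qK) (hS : PilotKummerIndRelated S P ρ qK) :
    Thm311ToCor312.Licence P :=
  Thm311ToCor312.licence_of_qRegion_mem_possibleImages P fun i vQ =>
    (reading3_iff_pilotKummerIndRelated S P ρ qK hKumB hpin).2 hS (Setting.labelSucc i) vQ

/-- `Thm311Charitable_4` with the TWO region pins for the q-datum `Q.qΨ P.n m₁` gives the `Licence` (S is pin-free, p433392
`s_of_charitable_4_pinFree`; (ii)(b) at column `n` is a conjunct of the reading). [claim: Mochizuki2012, status: disputed] -/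
theorem licence_of_charitable_4_pinned (Q : LinkKummerData S) (m₁ : ℤ)
    (h : Summit.ABC.IUTFork.Charitable.Thm311Charitable_4 S Q) (hpin : PinnedRegions S P ρ (Q.qΨ P.n m₁)) :
    Thm311ToCor312.Licence P :=
  licence_of_s_pinned S P ρ (h.2.1 P.n).2.1 hpin (s_of_charitable_4_pinFree S Q P ρ m₁ h)

/-- **SCHEMA 1.** Wherever «(ii)(b) at column `n` + the two region pins ⟹ ¬S» holds for every q-datum, the charitable reading cannot be
pinned: `¬ (Thm311Charitable_4 ∧ PinnedRegions)` for every link/Kummer datum and vertical index. [claim: Mochizuki2012, status: disputed] -/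
theorem not_charitable_4_and_pinned_of_not_s
    (hNS : ∀ qK : ∀ v : T.V, v ∈ T.Vbad → Set (S.L.StarPacket v),
      (S.col P.n).KummerB (S.D P.n) → PinnedRegions S P ρ qK → ¬ PilotKummerIndRelated S P ρ qK)
    (Q : LinkKummerData S) (m₁ : ℤ) :
    ¬ (Summit.ABC.IUTFork.Charitable.Thm311Charitable_4 S Q ∧ PinnedRegions S P ρ (Q.qΨ P.n m₁)) := fun h =>
  hNS _ (h.1.2.1 P.n).2.1 h.2 (s_of_charitable_4_pinFree S Q P ρ m₁ h.1)

/-- **SCHEMA 2.** Wherever the (xi-f) `Licence` fails, the charitable reading cannot be pinned. [claim: Mochizuki2012, status: disputed] -/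
theorem not_charitable_4_and_pinned_of_not_licence (hL : ¬ Thm311ToCor312.Licence P) (Q : LinkKummerData S) (m₁ : ℤ) :
    ¬ (Summit.ABC.IUTFork.Charitable.Thm311Charitable_4 S Q ∧ PinnedRegions S P ρ (Q.qΨ P.n m₁)) := fun h =>
  hL (licence_of_charitable_4_pinned S P ρ Q m₁ h.1 h.2)

/-- **SCHEMA 3 (the hedge-honouring reading).** Wherever the `Licence` fails, the (Ind3)-hedged reading (L^⊆) of p437900 with (Q′) and the
literal (i)–(iii) cannot be pinned under ANY MONOTONE region reading (p443687 `D4Upper.licence_of_upper`).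
[claim: Mochizuki2012, status: disputed] -/
theorem not_upper_4_and_pinned_of_not_licence (hL : ¬ Thm311ToCor312.Licence P) (Q : LinkKummerData S) (m₁ : ℤ) :
    ¬ ((Thm311Literal_4 S Q ∧ QKummerCoric S Q ∧ LinkKummerCompatUpper S Q) ∧ RegionMonotone S.L ρ ∧
        PinnedRegions S P ρ (Q.qΨ P.n m₁)) := fun ⟨⟨hlit, _, hU⟩, hρ, hpin⟩ =>
  hL (licence_of_upper P ρ hlit.1.2.2 (fun n => (hlit.2.1 n).2.1) hpin hρ hU)

end Pins

/-! ## 3. Genuine carriers: unsatisfiable with the pins, for EVERY initial Θ-datum and EVERY q-idele -/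

section Genuine

variable {F : Type} [Field F] [NumberField F] (X : PilotData F) {logv : PadicLogs F} (hlog : LogvAnalytic logv)
  (M : Type) [Field M] [NumberField M]
  (archPk : ∀ (j : (thetaIndex X).Label) (vQ : (thetaIndex X).VQ), Set ((logShellsDH X logv).Packet j vQ))
  (archSub : ∀ (j : (thetaIndex X).Label) (v : (thetaIndex X).V),
    Set ((logShellsDH X logv).Packet j ((thetaIndex X).over v)))
  (Ψ : ℤ → ∀ v : (thetaIndex X).V, v ∈ (thetaIndex X).Vbad → Set ((logShellsDH X logv).StarPacket v))
  (act : ℤ → ∀ v : (thetaIndex X).V, v ∈ (thetaIndex X).Vbad →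
    (logShellsDH X logv).StarPacket v → Module.End ℚ ((logShellsDH X logv).StarPacket v))
  (Mmod : ℤ → ∀ j : (thetaIndex X).LabelStar, Set ((logShellsDH X logv).GlobalPacket j.1))
  (region : ℤ → ∀ j : (thetaIndex X).LabelStar, FinDivisor M → ∀ vQ : (thetaIndex X).VQ,
    Set ((logShellsDH X logv).Packet j.1 vQ))
  (frobAdm : ℤ → ℤ → ∀ (j : (thetaIndex X).Label) (vQ : (thetaIndex X).VQ),
    Set ((logShellsDH X logv).Packet j vQ) → Prop)
  (frobLogvol : ℤ → ℤ → ∀ (j : (thetaIndex X).Label) (vQ : (thetaIndex X).VQ),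
    Set ((logShellsDH X logv).Packet j vQ) → ℝ)
  (frobΨ : ℤ → ℤ → ∀ v : (thetaIndex X).V, v ∈ (thetaIndex X).Vbad → Set ((logShellsDH X logv).StarPacket v))
  (frobMmod : ℤ → ℤ → ∀ j : (thetaIndex X).LabelStar, Set ((logShellsDH X logv).GlobalPacket j.1))
  (unitImage : ℤ → ℤ → ℕ → ∀ (j : (thetaIndex X).Label) (vQ : (thetaIndex X).VQ),
    Set ((logShellsDH X logv).Packet j vQ))
  (ballImage : ℤ → ℤ → ∀ (j : (thetaIndex X).Label) (vQ : (thetaIndex X).VQ),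
    Set ((logShellsDH X logv).Packet j vQ))
  (thetaDiv : ℤ → ℤ → LgpDivisor M (thetaIndex X).lstar)
  (n : ℤ) {HT : Type} {LogLink : HT → HT → Type} {IsFull : ∀ {s t : HT}, LogLink s t → Prop}
  (lat : LGPGaussianLogThetaLattice LogLink IsFull)
  {Frd : Type} {IsoF : Frd → Frd → Type} {Ob : Frd → Type} {realify : Frd → Frd} {Strip : Type}
  {IsoS : Strip → Strip → Type} {Mv : ∀ v : (thetaIndex X).V, v ∈ (thetaIndex X).Vbad → Type}
  [∀ v h, Monoid (Mv v h)]
  (sig : GlobalLGPFrobenioidSignature (thetaIndex X).lstar (thetaIndex X).V (· ∈ (thetaIndex X).Vbad)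
    Frd IsoF Ob realify Strip IsoS Mv)
  (split : SplittingMonoids Mv) {ObΔ : Type} {N : ∀ v : (thetaIndex X).V, v ∈ (thetaIndex X).Vbad → Type}
  [∀ v h, Monoid (N v h)] (qData : QPilotData ObΔ N)
  (t : ∀ (pp : Nat.Primes) (_ : Fin X.lstar) (x : (thetaIndex X).Fibre (.inr pp)),
    haveI : Fact (pp : ℕ).Prime := ⟨pp.2⟩; kOf X pp.1 x)
  (tq : ∀ (pp : Nat.Primes) (x : (thetaIndex X).Fibre (.inr pp)), haveI : Fact (pp : ℕ).Prime := ⟨pp.2⟩; kOf X pp.1 x)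

/-- **GENUINE CARRIERS, TWO PINS — for EVERY initial Θ-datum `X`, EVERY nonzero q-idele family that is a unit off `S`, every link/Kummer
datum `Q`, region reading `ρ` and vertical index `m₁`**: team D4's maximally-charitable Theorem 3.11 together with the Corollary's two
region pins (pΘ) ∧ (pq′) for the q-datum `Q.qΨ n m₁` is FALSE at abc-iut-c312-7's print-normalised sharp setting `settingPrVolSharp`
(Θ-ideles realising `P_Θ`). Proof: the reading gives S pin-free (p433392) and (ii)(b) at column `n`; abc-iut-E-t44's
`not_pilotKummerIndRelated_settingPrVolSharp_of_pinned_anyQ` refutes S under the two pins (the Θ-volumes `A_p ≠ 4·A_p` at labels 1, 2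
against the label-independent q-volume). [claim: Mochizuki2012, status: disputed] [cite: DupuyHilado2025, §3.3–§3.4, Thm. 3.10.1] -/
theorem not_charitable_4_and_pinned_settingPrVolSharp (ht0 : ∀ pp i x, t pp i x ≠ 0)
    (ht : ∀ (pp : Nat.Primes) (i : Fin X.lstar) (x : (thetaIndex X).Fibre (.inr pp)),
      haveI : Fact (pp : ℕ).Prime := ⟨pp.2⟩
      Real.log ‖t pp i x‖ = -(X.thetaPilot i (placeOf X pp.1 x)) * logNorm F (placeOf X pp.1 x) /
        localDegree F (placeOf X pp.1 x))
    (htq0 : ∀ pp x, tq pp x ≠ 0)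
    (htq1 : ∀ (pp : Nat.Primes) (x : (thetaIndex X).Fibre (.inr pp)),
      haveI : Fact (pp : ℕ).Prime := ⟨pp.2⟩; placeOf X pp.1 x ∉ X.S → ‖tq pp x‖ = 1)
    (Q : LinkKummerData
      (LatticeSituation.ofShells (logShellsDH X logv) M archPk archSub (summandPiecesPr X hlog).Adm
        (summandPiecesPr X hlog).logvol Ψ act Mmod region frobAdm frobLogvol frobΨ frobMmod unitImage ballImage thetaDiv))
    (ρ : (∀ v : (thetaIndex X).V, v ∈ (thetaIndex X).Vbad → Set ((logShellsDH X logv).StarPacket v)) →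
      ∀ (j : (thetaIndex X).Label) (vQ : (thetaIndex X).VQ), Set ((logShellsDH X logv).Packet j vQ))
    (m₁ : ℤ) :
    ¬ (Summit.ABC.IUTFork.Charitable.Thm311Charitable_4
          (LatticeSituation.ofShells (logShellsDH X logv) M archPk archSub (summandPiecesPr X hlog).Adm
            (summandPiecesPr X hlog).logvol Ψ act Mmod region frobAdm frobLogvol frobΨ frobMmod unitImage ballImage thetaDiv) Q ∧
        Cor312Vol.PinnedRegions
          (LatticeSituation.ofShells (logShellsDH X logv) M archPk archSub (summandPiecesPr X hlog).Adm
            (summandPiecesPr X hlog).logvol Ψ act Mmod region frobAdm frobLogvol frobΨ frobMmod unitImage ballImage thetaDiv)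
          (settingPrVolSharp X hlog M archPk archSub Ψ act Mmod region n lat sig split qData tq t htq0 htq1) ρ (Q.qΨ n m₁)) :=
  not_charitable_4_and_pinned_of_not_s _ _ ρ
    (fun qK hB hpin => not_pilotKummerIndRelated_settingPrVolSharp_of_pinned_anyQ X hlog M archPk archSub Ψ act Mmod region
      frobAdm frobLogvol frobΨ frobMmod unitImage ballImage thetaDiv n lat sig split qData t tq ρ qK ht0 ht htq0 htq1 hB hpin)
    Q m₁

/-- The same under the THREE pins `Cor312Vol.PinnedRegions3` of the adjudication (the link pin idle). [claim: Mochizuki2012, status: disputed] -/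
theorem not_charitable_4_and_pinned3_settingPrVolSharp (ht0 : ∀ pp i x, t pp i x ≠ 0)
    (ht : ∀ (pp : Nat.Primes) (i : Fin X.lstar) (x : (thetaIndex X).Fibre (.inr pp)),
      haveI : Fact (pp : ℕ).Prime := ⟨pp.2⟩
      Real.log ‖t pp i x‖ = -(X.thetaPilot i (placeOf X pp.1 x)) * logNorm F (placeOf X pp.1 x) /
        localDegree F (placeOf X pp.1 x))
    (htq0 : ∀ pp x, tq pp x ≠ 0)
    (htq1 : ∀ (pp : Nat.Primes) (x : (thetaIndex X).Fibre (.inr pp)),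
      haveI : Fact (pp : ℕ).Prime := ⟨pp.2⟩; placeOf X pp.1 x ∉ X.S → ‖tq pp x‖ = 1)
    (Q : LinkKummerData
      (LatticeSituation.ofShells (logShellsDH X logv) M archPk archSub (summandPiecesPr X hlog).Adm
        (summandPiecesPr X hlog).logvol Ψ act Mmod region frobAdm frobLogvol frobΨ frobMmod unitImage ballImage thetaDiv))
    (ρ : (∀ v : (thetaIndex X).V, v ∈ (thetaIndex X).Vbad → Set ((logShellsDH X logv).StarPacket v)) →
      ∀ (j : (thetaIndex X).Label) (vQ : (thetaIndex X).VQ), Set ((logShellsDH X logv).Packet j vQ))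
    (m₁ : ℤ) :
    ¬ (Summit.ABC.IUTFork.Charitable.Thm311Charitable_4
          (LatticeSituation.ofShells (logShellsDH X logv) M archPk archSub (summandPiecesPr X hlog).Adm
            (summandPiecesPr X hlog).logvol Ψ act Mmod region frobAdm frobLogvol frobΨ frobMmod unitImage ballImage thetaDiv) Q ∧
        Cor312Vol.PinnedRegions3
          (LatticeSituation.ofShells (logShellsDH X logv) M archPk archSub (summandPiecesPr X hlog).Adm
            (summandPiecesPr X hlog).logvol Ψ act Mmod region frobAdm frobLogvol frobΨ frobMmod unitImage ballImage thetaDiv)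
          (settingPrVolSharp X hlog M archPk archSub Ψ act Mmod region n lat sig split qData tq t htq0 htq1) ρ (Q.qΨ n m₁)) :=
  fun h => not_charitable_4_and_pinned_settingPrVolSharp X hlog M archPk archSub Ψ act Mmod region frobAdm frobLogvol frobΨ frobMmod
    unitImage ballImage thetaDiv n lat sig split qData t tq ht0 ht htq0 htq1 Q ρ m₁ ⟨h.1, h.2.1⟩

/-- **GENUINE CENSUS (team D4 at the genuine carriers, one statement).** At the sharp genuine setting of ANY initial Θ-datum (binders as
above): (1) the charitable reading WITHOUT pins is exactly as satisfiable as the frozen (i) ∧ (ii) of the real lattice situation; (2) WITH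
the two region pins it is unsatisfiable for every link/Kummer datum, region reading and vertical index. [claim: Mochizuki2012, status: disputed] -/
theorem genuine_census (ht0 : ∀ pp i x, t pp i x ≠ 0)
    (ht : ∀ (pp : Nat.Primes) (i : Fin X.lstar) (x : (thetaIndex X).Fibre (.inr pp)),
      haveI : Fact (pp : ℕ).Prime := ⟨pp.2⟩
      Real.log ‖t pp i x‖ = -(X.thetaPilot i (placeOf X pp.1 x)) * logNorm F (placeOf X pp.1 x) /
        localDegree F (placeOf X pp.1 x))
    (htq0 : ∀ pp x, tq pp x ≠ 0)
    (htq1 : ∀ (pp : Nat.Primes) (x : (thetaIndex X).Fibre (.inr pp)),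
      haveI : Fact (pp : ℕ).Prime := ⟨pp.2⟩; placeOf X pp.1 x ∉ X.S → ‖tq pp x‖ = 1) :
    ((∃ Q : LinkKummerData
          (LatticeSituation.ofShells (logShellsDH X logv) M archPk archSub (summandPiecesPr X hlog).Adm
            (summandPiecesPr X hlog).logvol Ψ act Mmod region frobAdm frobLogvol frobΨ frobMmod unitImage ballImage thetaDiv),
        Summit.ABC.IUTFork.Charitable.Thm311Charitable_4 _ Q) ↔
      (LatticeSituation.ofShells (logShellsDH X logv) M archPk archSub (summandPiecesPr X hlog).Adm
          (summandPiecesPr X hlog).logvol Ψ act Mmod region frobAdm frobLogvol frobΨ frobMmod unitImage ballImage thetaDiv).PartI ∧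
        (LatticeSituation.ofShells (logShellsDH X logv) M archPk archSub (summandPiecesPr X hlog).Adm
          (summandPiecesPr X hlog).logvol Ψ act Mmod region frobAdm frobLogvol frobΨ frobMmod unitImage ballImage thetaDiv).PartII) ∧
    ∀ (Q : LinkKummerData
        (LatticeSituation.ofShells (logShellsDH X logv) M archPk archSub (summandPiecesPr X hlog).Adm
          (summandPiecesPr X hlog).logvol Ψ act Mmod region frobAdm frobLogvol frobΨ frobMmod unitImage ballImage thetaDiv))
      (ρ : (∀ v : (thetaIndex X).V, v ∈ (thetaIndex X).Vbad → Set ((logShellsDH X logv).StarPacket v)) →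
        ∀ (j : (thetaIndex X).Label) (vQ : (thetaIndex X).VQ), Set ((logShellsDH X logv).Packet j vQ))
      (m₁ : ℤ),
      ¬ (Summit.ABC.IUTFork.Charitable.Thm311Charitable_4 _ Q ∧
          Cor312Vol.PinnedRegions _
            (settingPrVolSharp X hlog M archPk archSub Ψ act Mmod region n lat sig split qData tq t htq0 htq1) ρ (Q.qΨ n m₁)) :=
  ⟨exists_charitable_4_iff _, fun Q ρ m₁ => not_charitable_4_and_pinned_settingPrVolSharp X hlog M archPk archSub Ψ act Mmod region
    frobAdm frobLogvol frobΨ frobMmod unitImage ballImage thetaDiv n lat sig split qData t tq ht0 ht htq0 htq1 Q ρ m₁⟩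

end Genuine

/-! ## 4. Genuine carriers, deep place: the hedge-honouring reading cannot be pinned monotonically either -/

section Deep

variable {F : Type} [Field F] [NumberField F] (X : PilotData F) {logv : PadicLogs F} (hlog : LogvAnalytic logv)
  (t : ∀ (pp : Nat.Primes) (_ : Fin X.lstar) (x : (thetaIndex X).Fibre (.inr pp)),
    haveI : Fact (pp : ℕ).Prime := ⟨pp.2⟩; kOf X pp.1 x)
  (tq : ∀ (pp : Nat.Primes) (x : (thetaIndex X).Fibre (.inr pp)),
    haveI : Fact (pp : ℕ).Prime := ⟨pp.2⟩; kOf X pp.1 x)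
  (M : Type) [Field M] [NumberField M]
  (archPk : ∀ (j : (thetaIndex X).Label) (vQ : (thetaIndex X).VQ), Set ((logShellsDH X logv).Packet j vQ))
  (archSub : ∀ (j : (thetaIndex X).Label) (v : (thetaIndex X).V),
    Set ((logShellsDH X logv).Packet j ((thetaIndex X).over v)))
  (Ψ : ℤ → ∀ v : (thetaIndex X).V, v ∈ (thetaIndex X).Vbad → Set ((logShellsDH X logv).StarPacket v))
  (act : ℤ → ∀ v : (thetaIndex X).V, v ∈ (thetaIndex X).Vbad →
    (logShellsDH X logv).StarPacket v → Module.End ℚ ((logShellsDH X logv).StarPacket v))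
  (Mmod : ℤ → ∀ j : (thetaIndex X).LabelStar, Set ((logShellsDH X logv).GlobalPacket j.1))
  (region : ℤ → ∀ j : (thetaIndex X).LabelStar, FinDivisor M → ∀ vQ : (thetaIndex X).VQ,
    Set ((logShellsDH X logv).Packet j.1 vQ))
  (n : ℤ) {HT : Type} {LogLink : HT → HT → Type} {IsFull : ∀ {s t : HT}, LogLink s t → Prop}
  (lat : LGPGaussianLogThetaLattice LogLink IsFull)
  {Frd : Type} {IsoF : Frd → Frd → Type} {Ob : Frd → Type} {realify : Frd → Frd} {Strip : Type}
  {IsoS : Strip → Strip → Type} {Mv : ∀ v : (thetaIndex X).V, v ∈ (thetaIndex X).Vbad → Type}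
  [∀ v h, Monoid (Mv v h)]
  (sig : GlobalLGPFrobenioidSignature (thetaIndex X).lstar (thetaIndex X).V (· ∈ (thetaIndex X).Vbad)
    Frd IsoF Ob realify Strip IsoS Mv)
  (split : SplittingMonoids Mv) {ObΔ : Type} {N : ∀ v : (thetaIndex X).V, v ∈ (thetaIndex X).Vbad → Type}
  [∀ v h, Monoid (N v h)] (qData : QPilotData ObΔ N)

/-- **GENUINE CARRIERS, DEEP PLACE — the HEDGED reading (L^⊆) + (Q′) + literal (i)–(iii), with a MONOTONE region reading and the two
region pins, is FALSE** at `settingPrVolSharp` with REALISING Θ- and q-ideles, for every column structure `col`, every link/Kummer datum,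
every `m₁`, as soon as some bad place `x₀ ∈ S` lies over an odd prime `p ∤ disc F` (any label `j = i+1 ≥ 2`): the conjunction gives the
(xi-f) `Licence` (p443687), refuted there by abc-iut-C-cert-1's `not_licence_settingPrVolSharp_of_realising`.
[claim: Mochizuki2012, status: disputed] [cite: DupuyHilado2025, §3.4, §3.9] -/
theorem not_upper_4_and_pinned_settingPrVolSharp_of_realising (ht0 : ∀ pp i x, t pp i x ≠ 0) (htq0 : ∀ pp x, tq pp x ≠ 0)
    (htq1 : ∀ (pp : Nat.Primes) (x : (thetaIndex X).Fibre (.inr pp)),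
      haveI : Fact (pp : ℕ).Prime := ⟨pp.2⟩; placeOf X pp.1 x ∉ X.S → ‖tq pp x‖ = 1)
    (ht : ∀ (pp : Nat.Primes) (i : Fin X.lstar) (x : (thetaIndex X).Fibre (.inr pp)),
      haveI : Fact (pp : ℕ).Prime := ⟨pp.2⟩
      Real.log ‖t pp i x‖ = -(X.thetaPilot i (placeOf X pp.1 x)) * logNorm F (placeOf X pp.1 x) /
        localDegree F (placeOf X pp.1 x))
    (htq : ∀ (pp : Nat.Primes) (x : (thetaIndex X).Fibre (.inr pp)),
      haveI : Fact (pp : ℕ).Prime := ⟨pp.2⟩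
      Real.log ‖tq pp x‖ = -(X.qPilot (placeOf X pp.1 x)) * logNorm F (placeOf X pp.1 x) /
        localDegree F (placeOf X pp.1 x))
    (i : Fin (thetaIndex X).lstar) (hi : 1 ≤ (i : ℕ)) (pp : Nat.Primes) [Fact (pp : ℕ).Prime] (hp2 : 2 < (pp : ℕ))
    (hdisc : ¬ ((pp : ℕ) : ℤ) ∣ NumberField.discr F)
    (x₀ : (thetaIndex X).Fibre (.inr pp)) (hx₀ : placeOf X pp.1 x₀ ∈ X.S)
    (col : ℤ → Column (logShellsDH X logv))
    (Q : LinkKummerData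
      ({ toSituation := situationPrVol X hlog M archPk archSub Ψ act Mmod region, col := col } :
        LatticeSituation (thetaIndex X)))
    (ρ : (∀ v : (thetaIndex X).V, v ∈ (thetaIndex X).Vbad → Set ((logShellsDH X logv).StarPacket v)) →
      ∀ (j : (thetaIndex X).Label) (vQ : (thetaIndex X).VQ), Set ((logShellsDH X logv).Packet j vQ))
    (m₁ : ℤ) :
    ¬ ((Thm311Literal_4
            ({ toSituation := situationPrVol X hlog M archPk archSub Ψ act Mmod region, col := col } :
              LatticeSituation (thetaIndex X)) Q ∧
          QKummerCoric
            ({ toSituation := situationPrVol X hlog M archPk archSub Ψ act Mmod region, col := col } :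
              LatticeSituation (thetaIndex X)) Q ∧
          LinkKummerCompatUpper
            ({ toSituation := situationPrVol X hlog M archPk archSub Ψ act Mmod region, col := col } :
              LatticeSituation (thetaIndex X)) Q) ∧
        RegionMonotone (logShellsDH X logv) ρ ∧
        Cor312Vol.PinnedRegions
          ({ toSituation := situationPrVol X hlog M archPk archSub Ψ act Mmod region, col := col } :
            LatticeSituation (thetaIndex X))
          (settingPrVolSharp X hlog M archPk archSub Ψ act Mmod region n lat sig split qData tq t htq0 htq1) ρ (Q.qΨ n m₁)) :=
  fun h => not_upper_4_and_pinned_of_not_licence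
    ({ toSituation := situationPrVol X hlog M archPk archSub Ψ act Mmod region, col := col } : LatticeSituation (thetaIndex X)) _ ρ
    (not_licence_settingPrVolSharp_of_realising X hlog t tq M archPk archSub Ψ act Mmod region n lat sig split qData ht0 htq0 htq1
      ht htq i hi pp hp2 hdisc x₀ hx₀) Q m₁ h

/-- … and the UNHEDGED charitable reading a fortiori (no monotonicity needed): at the same deep place, `¬ (Thm311Charitable_4 ∧ PinnedRegions)`
for every column structure — the `Licence` route, independent of §3's volume route. [claim: Mochizuki2012, status: disputed] -/
theorem not_charitable_4_and_pinned_settingPrVolSharp_of_realising (ht0 : ∀ pp i x, t pp i x ≠ 0) (htq0 : ∀ pp x, tq pp x ≠ 0)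
    (htq1 : ∀ (pp : Nat.Primes) (x : (thetaIndex X).Fibre (.inr pp)),
      haveI : Fact (pp : ℕ).Prime := ⟨pp.2⟩; placeOf X pp.1 x ∉ X.S → ‖tq pp x‖ = 1)
    (ht : ∀ (pp : Nat.Primes) (i : Fin X.lstar) (x : (thetaIndex X).Fibre (.inr pp)),
      haveI : Fact (pp : ℕ).Prime := ⟨pp.2⟩
      Real.log ‖t pp i x‖ = -(X.thetaPilot i (placeOf X pp.1 x)) * logNorm F (placeOf X pp.1 x) /
        localDegree F (placeOf X pp.1 x))
    (htq : ∀ (pp : Nat.Primes) (x : (thetaIndex X).Fibre (.inr pp)),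
      haveI : Fact (pp : ℕ).Prime := ⟨pp.2⟩
      Real.log ‖tq pp x‖ = -(X.qPilot (placeOf X pp.1 x)) * logNorm F (placeOf X pp.1 x) /
        localDegree F (placeOf X pp.1 x))
    (i : Fin (thetaIndex X).lstar) (hi : 1 ≤ (i : ℕ)) (pp : Nat.Primes) [Fact (pp : ℕ).Prime] (hp2 : 2 < (pp : ℕ))
    (hdisc : ¬ ((pp : ℕ) : ℤ) ∣ NumberField.discr F)
    (x₀ : (thetaIndex X).Fibre (.inr pp)) (hx₀ : placeOf X pp.1 x₀ ∈ X.S)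
    (col : ℤ → Column (logShellsDH X logv))
    (Q : LinkKummerData
      ({ toSituation := situationPrVol X hlog M archPk archSub Ψ act Mmod region, col := col } :
        LatticeSituation (thetaIndex X)))
    (ρ : (∀ v : (thetaIndex X).V, v ∈ (thetaIndex X).Vbad → Set ((logShellsDH X logv).StarPacket v)) →
      ∀ (j : (thetaIndex X).Label) (vQ : (thetaIndex X).VQ), Set ((logShellsDH X logv).Packet j vQ))
    (m₁ : ℤ) :
    ¬ (Summit.ABC.IUTFork.Charitable.Thm311Charitable_4
          ({ toSituation := situationPrVol X hlog M archPk archSub Ψ act Mmod region, col := col } :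
            LatticeSituation (thetaIndex X)) Q ∧
        Cor312Vol.PinnedRegions
          ({ toSituation := situationPrVol X hlog M archPk archSub Ψ act Mmod region, col := col } :
            LatticeSituation (thetaIndex X))
          (settingPrVolSharp X hlog M archPk archSub Ψ act Mmod region n lat sig split qData tq t htq0 htq1) ρ (Q.qΨ n m₁)) :=
  not_charitable_4_and_pinned_of_not_licence _ _ ρ
    (not_licence_settingPrVolSharp_of_realising X hlog t tq M archPk archSub Ψ act Mmod region n lat sig split qData ht0 htq0 htq1
      ht htq i hi pp hp2 hdisc x₀ hx₀) Q m₁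

end Deep

end Summit.ABC.IUTFork.Charitable.D4Genuine

end
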